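import Summits.BirchSwinnertonDyer.BirchSwinnertonDyer.Theorems.EisensteinPrimesMazurMCOnCellBTwistbackZigzagClassData
import Summits.BirchSwinnertonDyer.Rank1Residual.X2.RankOneNonsplitTransfer
import HarnessLib

/-!
# Crux 3 `MazurMCOnCellB` (stmt-BirchSwinnertonDyer-19033), line `twistback` v10/v11 — THE SPLIT / NON-SPLIT TYPE AT `p`
# IS CONSTANT ON ZIG-ZAG COMPONENTS: a split X2b pair is connected to split pairs only, a non-split one to non-split ones

Width seat bsd-line-x2-p1-w3 (gen 15), cell `bsd-eis`, 2026-08-28; lane F2f (sequel of F2d p674224 `…ZigzagClassData` /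
F2e p676079 `…ZigzagTwistFamily`). `--supports stmt-BirchSwinnertonDyer-19033 --as helper`. HONEST FRAMING: THEOREMS ONLY
(no `def`, no named fact introduced, no `sorry`), conditional on modularity (`hasEntireLFunction_rat`, for the rank-`0`
reading that carries X2b along edges) where marked; closes no registered stub; no summit statement, no Mazur main
conjecture and no case of BSD is proved for any curve; 0 cells / labels / stubs / tiers move.

## What

LEAD g15's planned RESHAPE v10 → v11 (HOME STATUS 2026-08-28T22:43:02Z) adds to the kernel stub one more negated
hypothesis: «some vertex `W₀` of the zig-zag component of `W`'s class is NON-split at `p` and carries an order-one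
admissible twist». This file shows in the kernel that the reduction TYPE at `p` does not move along zig-zags:

* §1 `hasSplitMultiplicativeReductionAtPrime_iff_of_twoStepAt` — along ONE certified two-step edge out of an X2 pair
  the far end is split at `p` iff the start is: both fields `K`, `K″` have `p` SPLIT, so each of the two twists is by a
  discriminant that is a non-zero square mod `p` (cell b2b's `X2.hasSplitMultiplicativeReductionAtPrime_iff_of_smul_eq_quadraticTwist`,
  Silverman VII.5.1(b), X.5.4), applied at `W` and at the intermediate X2 pair `Wd` (`X2.classX2_twist`).
* §2 `hasSplitMultiplicativeReductionAtPrime_iff_of_zigzag` — along any zig-zag `W ⇝ U` out of an X2b pair (relation of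
  p671590 / twistback v10 VERBATIM) `U` is split at `p` iff `W` is (forward steps: §1 at the running X2b vertex,
  `cellB_of_cellB_of_zigzag`; backward steps: §1 at the far vertex, whose X2b assertion the relation carries, read
  backwards).
* §3 the v11 reading: `hasSplit_of_zigzag_of_hasSplit` / `not_hasSplit_of_zigzag_of_not_hasSplit`, and with the
  isogeny at the start folded in (`a_p` is an isogeny invariant: `X2.IsogenyQuotientLine.hasSplitMultiplicativeReductionAtPrime_iff_of_isIsogenous`;
  X2b is a class property: `X2.cellB_iff_of_isIsogenous`, Tate uniformisation discharged)
  `not_exists_isIsogenous_zigzag_nonsplit_of_hasSplit` — **at a SPLIT X2b pair `(W, p)` there is no `W₁ ∼ W` and no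
  zig-zag `W₁ ⇝ W₀` with `(W₀, p)` non-split** — and `not_hasSplit_of_isIsogenous_zigzag_of_not_hasSplit` (at a non-split
  pair every such `W₀` is non-split). So v11's new exclusion bites only on the components of NON-split pairs
  (sub-populations (ii)/(iii) of LEAD g14's verdict §2); on the 83 split A10 cells the registered open content is
  unchanged by it. Bookkeeping for the LEAD; nothing is booked.

References: p667979 (`TwoStepAt`, `cellB_of_cellB_of_twoStepAt`), p671590, p674224, p676079; LEAD g15 PLAN l.4164;
`X2/RankOneNonsplitTransfer` (cell b2b); Silverman, *AEC* VII.5 Prop. 5.1(b), X.5 Cor. 5.4 [SilvermanAEC2009].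
-/

set_option autoImplicit false
set_option linter.dupNamespace false -- `Summit.BirchSwinnertonDyer.BirchSwinnertonDyer.…`: summit = sub-problem name

noncomputable section

open scoped Classical

open WeierstrassCurve NumberField
  Literature.NumberTheory.EllipticCurves
  Literature.NumberTheory.EllipticCurves.ModularForms
  Literature.NumberTheory.QuadraticFields
  Literature.NumberTheory.EllipticCurves.Rank1Residual
  Literature.NumberTheory.EllipticCurves.Rank1Residual.Typed
  Summit.BirchSwinnertonDyer.Rank1Residual
  Summit.BirchSwinnertonDyer.BirchSwinnertonDyer.Theorems.EisensteinPrimesMazurMCOnCellBTwistbackTwoStepDefs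
  Summit.BirchSwinnertonDyer.BirchSwinnertonDyer.Theorems.EisensteinPrimesMazurMCOnCellBTwistbackZigzagClassData

namespace Summit.BirchSwinnertonDyer.BirchSwinnertonDyer.Theorems.EisensteinPrimesMazurMCOnCellBTwistbackZigzagSplitType

/-! ## §1. One edge: the far end is split at `p` iff the start is -/

/-- **The split / non-split type at `p` is preserved along a certified two-step edge out of an X2 pair.** If
`TwoStepAt p W W″` and `(W, p)` is an X2 pair (`p` odd, `E[p]` reducible, `p ‖ N`), then `W″` is split multiplicative
at `p` iff `W` is: `p` splits in `K` and in `K″`, so `W ↦ Wd` (a minimal model of `W^{(d_K)}`) and `Wd ↦ W″` (a minimal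
model of `Wd^{(d_{K″})}`) each preserve the type (`X2.hasSplitMultiplicativeReductionAtPrime_iff_of_smul_eq_quadraticTwist`),
`Wd` being an X2 pair again (`X2.classX2_twist`). Fact-free. [cite: SilvermanAEC2009, VII.5 Prop. 5.1(b) and X.5 Cor. 5.4] -/
theorem hasSplitMultiplicativeReductionAtPrime_iff_of_twoStepAt {p : ℕ} [Fact p.Prime]
    {W W'' : WeierstrassCurve ℚ} [W.IsElliptic] [W.IsGloballyMinimal] [W''.IsElliptic] [W''.IsGloballyMinimal]
    (hX : ClassX2 W p) (h : TwoStepAt p W W'') :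
    W''.HasSplitMultiplicativeReductionAtPrime p ↔ W.HasSplitMultiplicativeReductionAtPrime p := by
  obtain ⟨_, _, _, _, K, _, _, hK, -, hHp, -, -, -, Wd, _, _, hWd, K'', _, _, hK'', -, -, -, hHp'', -,
    ⟨C'', hC''⟩⟩ := h
  have hp2 : p ≠ 2 := hX.1
  obtain ⟨C, hC⟩ := hWd
  have hXd : ClassX2 Wd p := X2.classX2_twist W p hX K hK hHp Wd ⟨C, hC⟩
  have h1 : Wd.HasSplitMultiplicativeReductionAtPrime p ↔ W.HasSplitMultiplicativeReductionAtPrime p :=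
    X2.hasSplitMultiplicativeReductionAtPrime_iff_of_smul_eq_quadraticTwist W Wd hK p hp2 hX.2.2 hHp hC
  have h2 : W''.HasSplitMultiplicativeReductionAtPrime p ↔ Wd.HasSplitMultiplicativeReductionAtPrime p :=
    X2.hasSplitMultiplicativeReductionAtPrime_iff_of_smul_eq_quadraticTwist Wd W'' hK'' p hp2 hXd.2.2 hHp'' hC''
  exact h2.trans h1

/-! ## §2. Along zig-zags out of an X2b pair the type at `p` is constant -/

/-- **The split / non-split type at `p` is constant on the zig-zag component of an X2b pair.** If `(W, p)` is X2b and
`W ⇝ U` along the zig-zag relation of twistback v10 (forward edges `TwoStepAt p A B`; backward edges `TwoStepAt p B A`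
carrying the X2b assertion of `B`), then `U` is split multiplicative at `p` iff `W` is: induction — at a forward step
the running vertex is X2b (`cellB_of_cellB_of_zigzag`) and §1 applies; at a backward step §1 applies at the far vertex
(X2b by the relation) and is read backwards. Conditional on `hmod` only (the rank-`0` reading of
`cellB_of_cellB_of_twoStepAt`). [cite: SilvermanAEC2009, VII.5 Prop. 5.1(b) and X.5 Cor. 5.4] -/
theorem hasSplitMultiplicativeReductionAtPrime_iff_of_zigzag (hmod : WeierstrassCurve.hasEntireLFunction_rat)
    {p : ℕ} [Fact p.Prime] {W U : WeierstrassCurve ℚ} [W.IsElliptic] [W.IsGloballyMinimal]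
    [U.IsElliptic] [U.IsGloballyMinimal] (hc : X2.CellB W p)
    (h : Relation.ReflTransGen (fun A B : WeierstrassCurve ℚ ↦ TwoStepAt p A B ∨
      (TwoStepAt p B A ∧ ∃ (_ : B.IsElliptic) (_ : B.IsGloballyMinimal), X2.CellB B p)) W U) :
    U.HasSplitMultiplicativeReductionAtPrime p ↔ W.HasSplitMultiplicativeReductionAtPrime p := by
  have key : ∀ {b : WeierstrassCurve ℚ},
      Relation.ReflTransGen (fun A B : WeierstrassCurve ℚ ↦ TwoStepAt p A B ∨
        (TwoStepAt p B A ∧ ∃ (_ : B.IsElliptic) (_ : B.IsGloballyMinimal), X2.CellB B p)) W b →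
      ∀ (_ : b.IsElliptic) (_ : b.IsGloballyMinimal),
        b.HasSplitMultiplicativeReductionAtPrime p ↔ W.HasSplitMultiplicativeReductionAtPrime p := by
    intro b hb
    induction hb with
    | refl => intro _ _; exact Iff.rfl
    | @tail V U' hWV hVU ih =>
      intro _ _
      obtain ⟨hEV, hMV, hcV⟩ := cellB_of_cellB_of_zigzag hmod hc hWV
      have ihV := ih hEV hMV
      rcases hVU with hVU | ⟨hUV, _, _, hcU⟩
      · -- forward step `V → U'`: §1 at the X2b vertex `V`
        obtain ⟨_, _, _, _, -⟩ := id hVU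
        exact (hasSplitMultiplicativeReductionAtPrime_iff_of_twoStepAt hcV.2.1 hVU).trans ihV
      · -- backward step `V ← U'` with `(U', p)` X2b: §1 at `U'`, read backwards
        exact (hasSplitMultiplicativeReductionAtPrime_iff_of_twoStepAt hcU.2.1 hUV).symm.trans ihV
  exact key h inferInstance inferInstance

/-! ## §3. The v11 reading: no non-split vertex in the component of a split pair (and conversely) -/

/-- **Split start, split everywhere**: out of a SPLIT X2b pair every vertex of the zig-zag component is split at `p`.
Conditional on `hmod` only. [folklore] -/
theorem hasSplit_of_zigzag_of_hasSplit (hmod : WeierstrassCurve.hasEntireLFunction_rat)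
    {p : ℕ} [Fact p.Prime] {W U : WeierstrassCurve ℚ} [W.IsElliptic] [W.IsGloballyMinimal]
    [U.IsElliptic] [U.IsGloballyMinimal] (hc : X2.CellB W p) (hs : W.HasSplitMultiplicativeReductionAtPrime p)
    (h : Relation.ReflTransGen (fun A B : WeierstrassCurve ℚ ↦ TwoStepAt p A B ∨
      (TwoStepAt p B A ∧ ∃ (_ : B.IsElliptic) (_ : B.IsGloballyMinimal), X2.CellB B p)) W U) :
    U.HasSplitMultiplicativeReductionAtPrime p :=
  (hasSplitMultiplicativeReductionAtPrime_iff_of_zigzag hmod hc h).mpr hs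

/-- **Non-split start, non-split everywhere**: out of a NON-split X2b pair every vertex of the zig-zag component is
non-split at `p` — so LEAD g15's v11 anchor «a non-split vertex with an order-one admissible twist» is looked for among
non-split curves only, as the road-(b) certificates (x2-p1-w3 g11 p661229) require. Conditional on `hmod` only. [folklore] -/
theorem not_hasSplit_of_zigzag_of_not_hasSplit (hmod : WeierstrassCurve.hasEntireLFunction_rat)
    {p : ℕ} [Fact p.Prime] {W U : WeierstrassCurve ℚ} [W.IsElliptic] [W.IsGloballyMinimal]
    [U.IsElliptic] [U.IsGloballyMinimal] (hc : X2.CellB W p) (hns : ¬ W.HasSplitMultiplicativeReductionAtPrime p)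
    (h : Relation.ReflTransGen (fun A B : WeierstrassCurve ℚ ↦ TwoStepAt p A B ∨
      (TwoStepAt p B A ∧ ∃ (_ : B.IsElliptic) (_ : B.IsGloballyMinimal), X2.CellB B p)) W U) :
    ¬ U.HasSplitMultiplicativeReductionAtPrime p :=
  fun hs ↦ hns ((hasSplitMultiplicativeReductionAtPrime_iff_of_zigzag hmod hc h).mp hs)

/-- **v11's new negated hypothesis is vacuous at SPLIT pairs**: if `(W, p)` is a SPLIT X2b pair then there is NO
`W₁ ∼ W` and NO zig-zag `W₁ ⇝ W₀` with `(W₀, p)` NON-split — the split type and X2b move along the isogeny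
(`X2.IsogenyQuotientLine.hasSplitMultiplicativeReductionAtPrime_iff_of_isIsogenous`, `a_p` is an isogeny invariant;
`X2.cellB_iff_of_isIsogenous` with the Tate uniformisation facts DISCHARGED in the tree) and §2 carries the type to `W₀`.
This is the shape a v11 branch quantifies («∃ W₁ ∼ W, zig-zag W₁ ⇝ W₀, (W₀, p) non-split, …»): on the 83 split A10
cells the planned extra exclusion excludes nothing. Conditional on `hmod` only. [folklore] -/
theorem not_exists_isIsogenous_zigzag_nonsplit_of_hasSplit (hmod : WeierstrassCurve.hasEntireLFunction_rat)
    {p : ℕ} [Fact p.Prime] (W : WeierstrassCurve ℚ) [W.IsElliptic] [W.IsGloballyMinimal] (hc : X2.CellB W p)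
    (hs : W.HasSplitMultiplicativeReductionAtPrime p) :
    ¬ ∃ (W₁ : WeierstrassCurve ℚ) (_ : W₁.IsElliptic) (_ : W₁.IsGloballyMinimal)
        (W₀ : WeierstrassCurve ℚ) (_ : W₀.IsElliptic) (_ : W₀.IsGloballyMinimal),
      IsIsogenous W W₁ ∧
      Relation.ReflTransGen (fun A B : WeierstrassCurve ℚ ↦ TwoStepAt p A B ∨
        (TwoStepAt p B A ∧ ∃ (_ : B.IsElliptic) (_ : B.IsGloballyMinimal), X2.CellB B p)) W₁ W₀ ∧
      ¬ W₀.HasSplitMultiplicativeReductionAtPrime p := by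
  rintro ⟨W₁, _, _, W₀, _, _, hiso, hz, hns⟩
  have hc₁ : X2.CellB W₁ p :=
    (X2.cellB_iff_of_isIsogenous (p := p) TateCurve.Silverman1994_thmV53_tateUniformisation_holds
      TateCurve.Silverman1994_thmV53_corV54_tateUniformisation_holds hiso).mp hc
  have hs₁ : W₁.HasSplitMultiplicativeReductionAtPrime p :=
    (X2.IsogenyQuotientLine.hasSplitMultiplicativeReductionAtPrime_iff_of_isIsogenous (p := p) hiso).mp hs
  exact hns (hasSplit_of_zigzag_of_hasSplit hmod hc₁ hs₁ hz)

/-- **… and at NON-split pairs every vertex reached is non-split** (same transport): the v11 anchor `W₀` of a non-split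
X2b pair, if it exists, is a NON-split X2b pair, where the road-(b) order-one certificates (x2-p1-w3 g11 p661229) are
stated. Conditional on `hmod` only. [folklore] -/
theorem not_hasSplit_of_isIsogenous_zigzag_of_not_hasSplit (hmod : WeierstrassCurve.hasEntireLFunction_rat)
    {p : ℕ} [Fact p.Prime] (W : WeierstrassCurve ℚ) [W.IsElliptic] [W.IsGloballyMinimal] (hc : X2.CellB W p)
    (hns : ¬ W.HasSplitMultiplicativeReductionAtPrime p)
    {W₁ : WeierstrassCurve ℚ} [W₁.IsElliptic] [W₁.IsGloballyMinimal]
    {W₀ : WeierstrassCurve ℚ} [W₀.IsElliptic] [W₀.IsGloballyMinimal] (hiso : IsIsogenous W W₁)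
    (hz : Relation.ReflTransGen (fun A B : WeierstrassCurve ℚ ↦ TwoStepAt p A B ∨
      (TwoStepAt p B A ∧ ∃ (_ : B.IsElliptic) (_ : B.IsGloballyMinimal), X2.CellB B p)) W₁ W₀) :
    ¬ W₀.HasSplitMultiplicativeReductionAtPrime p := by
  have hc₁ : X2.CellB W₁ p :=
    (X2.cellB_iff_of_isIsogenous (p := p) TateCurve.Silverman1994_thmV53_tateUniformisation_holds
      TateCurve.Silverman1994_thmV53_corV54_tateUniformisation_holds hiso).mp hc
  have hns₁ : ¬ W₁.HasSplitMultiplicativeReductionAtPrime p := fun h ↦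
    hns ((X2.IsogenyQuotientLine.hasSplitMultiplicativeReductionAtPrime_iff_of_isIsogenous (p := p) hiso).mpr h)
  exact not_hasSplit_of_zigzag_of_not_hasSplit hmod hc₁ hns₁ hz

end Summit.BirchSwinnertonDyer.BirchSwinnertonDyer.Theorems.EisensteinPrimesMazurMCOnCellBTwistbackZigzagSplitType

end
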